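import Summits.BirchSwinnertonDyer.BirchSwinnertonDyer.Theorems.AlignedTransportAtTwoMainConjectureOfRankZeroBSDAtTwoFineRoadCokerAtTwo
import Summits.BirchSwinnertonDyer.BirchSwinnertonDyer.Theorems.AlignedTransportAtTwoMainConjectureOfRankZeroBSDAtTwoFineRoadLambdaModP
import Literature.NumberTheory.EllipticCurves.KatoFineSelmerDualRelaxedAtInfinity
import Literature.NumberTheory.EllipticCurves.IwasawaEulerCharDualityProofs
import Literature.NumberTheory.GaloisRepresentations.CyclotomicCharacterSurjectiveProofs
import Mathlib.Algebra.Module.CharacterModule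
import Mathlib.RingTheory.Polynomial.Cyclotomic.Roots
import HarnessLib

/-!
# Road (b″) netted, the fine comparison `fyʳ : Y'_Δ → X₀^{rel ∞}(E/ℚ_∞)` — receptacle-free Pontryagin packaging:
# `ker fyʳ ≅ (Sel₀(ℚ(ζ_{2^∞}))^Δ / res Sel₀^{rel ∞}(ℚ_∞))^∨` is FINITE on the seed cell, so `ℓ₍₂₎(ker fyʳ) = 0`

Cell `bsd-f1-sign2`, WIDTH-5 attach seat `bsd-line-att-p4` (gen 4) on line `birth` of crux C2
stmt-BirchSwinnertonDyer-22298 `MainConjectureOfRankZeroBSDAtTwo`; a `--supports 22298 --as helper` file, companion of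
`…FineRoadArchKernel` (the archimedean extension `q`) and consumer of `…FineRoadCokerAtTwo` (`coker res₀` finite). HONEST FRAMING:
THEOREMS ONLY — no definition, no named fact, no `sorry`; BSD is NOT proved by any of this.

WHY. The displayed `KatoNetDataRelAtTwo` (K₂ⁿᵉᵗʳ) asks, inside its `∃`, for a fine comparison
`fyr : (Y' ⧸ range (cY - 1)) →ₗ[Λ] Yr.X` with `ℓ₍₂₎(ker fyr) = 0`, where `Y'` is Kato's `X₀(E/ℚ(ζ_{2^∞}))` with its `Δ`-action
`cY` and `Yr` the pinned relaxed fine dual over `ℚ_∞` (typer p600292). Whatever receptacle pins `Y'` to the tree's fine Selmer group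
over `ker χ₂` (an additive bijection `toDual'` with `toDual' (cY y) u = toDual' y (conj_c u)`), the conjunct FOLLOWS from this file:

* §1 (abstract: `U` an abelian group with an endomorphism `cU`, `res₀ : R₀ → U` landing in the fixed points of `cU`, pinned duals
  `Y ≅ Hom(U, ℚ/ℤ)`, `Yr ≅ Hom(R₀, ℚ/ℤ)`, `cY` dual to `cU`, `f` dual to `res₀`): `apply_sub_eq_zero` (`f` kills `(cY − 1)Y`),
  **`exists_eq_sub_of_forall_fixed_eq_zero`** (a character vanishing on the fixed points `U^{cU}` lies in `(cY − 1)Y` — `ℚ/ℤ` is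
  divisible, Mathlib `CharacterModule.dual_surjective_of_injective`), **`finite_ker_liftQ`** (for `Λ`-linear data: the kernel of the
  induced `(Y ⧸ range(cY − 1)) → Yr` embeds into `Hom(U^{cU} / res₀ R₀, ℚ/ℤ)`, finite when `U^{cU}/res₀ R₀` is), and
  `lengthAt_ker_liftQ_eq_zero` (`ℓ₍₂₎ = 0`, by `LambdaModP.lengthAt_augIdealP_eq_zero_of_finite`).
* §2 (seed cell: `W/ℚ` elliptic without rational `2`-torsion, cyclotomic `κ` with generator `γ`, `c ∈ Γ_ℚ` with `χ₂(c) = −1`, `Yr` the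
  pinned relaxed fine dual `W.FineSelmerDualDataRelaxedInf κ γ`): `exists_cyclotomicCharacter_eq_neg_one`, `conjH1_eq_of_mem_kerSubgroup`
  (`Δ = ⟨c̄⟩`: invariance under `conj_c` ⟹ invariance under every `g ∈ ker κ`), **`finite_fixed_quotient_range`** (the fixed
  fine classes upstairs modulo `res Sel₀^{rel ∞}(ℚ_∞)` are finite — `CokerAtTwo.finite_coker_fineRestriction_two` re-run on `U^{c}`),
  and the conjunct itself **`lengthAt_ker_fineComparison_eq_zero`**: for ANY `Λ`-module `Y'` pinned to
  `Sel₀(ℚ(ζ_{2^∞}), E[2^∞])` with `Δ`-action `cY` dual to `conj_c` and ANY `Λ`-linear `fyr : Y' ⧸ range(cY − 1) → Yr.X` dual to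
  `res₀`, **`ℓ₍₂₎(ker fyr) = 0`** (indeed `ker fyr` is finite) — no Imai, no Ribet, both signs of `Δ_W`.

References: R. Greenberg, LNM 1716 (1999), §3 (restriction maps) and §4 (PDF p. 106); K. Kato, Astérisque 295 §17.13;
J.-P. Serre, *Cours d'arithmétique* VI §1 (duality of finite abelian groups).
-/

set_option autoImplicit false
-- the Theorems namespace of this sub repeats the summit name by design (D-0017 nested layout)
set_option linter.dupNamespace false

noncomputable section

open scoped Classical

namespace Summit.BirchSwinnertonDyer.BirchSwinnertonDyer.Theorems.AlignedTransportAtTwoFineRoad.FineKernel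

open Literature.NumberTheory.EllipticCurves Literature.NumberTheory.EllipticCurves.IwasawaAlgebra
  Literature.NumberTheory.EllipticCurves.Module

/-! ## §1 Abstract: the dual of a map into the fixed points, read on coinvariants -/

section Abstract

variable {U : Type*} [AddCommGroup U] (cU : U →+ U) {R₀ : Type*} [AddCommGroup R₀] (res₀ : R₀ →+ U)
  {Y Yr : Type*} [AddCommGroup Y] [AddCommGroup Yr]
  (toDual : Y →+ (U →+ AddCircle (1 : ℚ))) (toDualR : Yr →+ (R₀ →+ AddCircle (1 : ℚ)))
  (cY : Y →+ Y) (f : Y →+ Yr)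

/-- **`f` kills `(cY − 1)Y`**: if `res₀` lands in the fixed points of `cU`, `cY` is dual to `cU` and `f` is dual to `res₀`, then
`f (cY y − y) = 0` (`toDualR` injective). [cite: GreenbergLNM1716, §3] -/
theorem apply_sub_eq_zero (hR : Function.Bijective toDualR) (hres : ∀ r, cU (res₀ r) = res₀ r)
    (hcY : ∀ (y : Y) (u : U), toDual (cY y) u = toDual y (cU u))
    (hf : ∀ (y : Y) (r : R₀), toDualR (f y) r = toDual y (res₀ r)) (y : Y) :
    f (cY y - y) = 0 := by
  apply hR.injective
  rw [map_zero]
  ext r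
  rw [map_sub, map_sub, AddMonoidHom.sub_apply, hf, hf, hcY, hres, sub_self, AddMonoidHom.zero_apply]

/-- **A character vanishing on the fixed points lies in `(cY − 1)Y`.** If `toDual y` vanishes on `U^{cU} = ker(cU − 1)`, it
factors through `U/ker(cU − 1) ≅ (cU − 1)U`; extend the resulting character of `(cU − 1)U ≤ U` to `U` (`ℚ/ℤ` divisible:
`CharacterModule.dual_surjective_of_injective`), pull back through `toDual`: the result `z` has `cY z − z = y`. [folklore] -/
theorem exists_eq_sub_of_forall_fixed_eq_zero (hD : Function.Bijective toDual)
    (hcY : ∀ (y : Y) (u : U), toDual (cY y) u = toDual y (cU u))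
    {y : Y} (hy : ∀ u : U, cU u = u → toDual y u = 0) : ∃ z : Y, cY z - z = y := by
  set δ : U →+ U := cU - AddMonoidHom.id U with hδ
  have hδapp : ∀ u, δ u = cU u - u := fun u ↦ rfl
  -- `toDual y` factors through `U ⧸ ker δ`
  have hle : δ.ker ≤ (toDual y).ker := by
    intro u hu
    rw [AddMonoidHom.mem_ker] at hu ⊢
    exact hy u (sub_eq_zero.mp (by rw [← hδapp]; exact hu))
  set ψ : U ⧸ δ.ker →+ AddCircle (1 : ℚ) := QuotientAddGroup.lift δ.ker (toDual y) hle with hψ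
  set e := QuotientAddGroup.quotientKerEquivRange δ with he
  have he_mk : ∀ u : U, e (QuotientAddGroup.mk u) = ⟨δ u, ⟨u, rfl⟩⟩ := fun u ↦ rfl
  set w : δ.range →+ AddCircle (1 : ℚ) := ψ.comp e.symm.toAddMonoidHom with hw
  have hw_apply : ∀ u : U, w ⟨δ u, ⟨u, rfl⟩⟩ = toDual y u := by
    intro u
    rw [hw, AddMonoidHom.comp_apply, AddEquiv.coe_toAddMonoidHom, ← he_mk, AddEquiv.symm_apply_apply, hψ,
      QuotientAddGroup.lift_mk]
  -- extend `w` to `U`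
  have hinj : Function.Injective δ.range.subtype.toIntLinearMap := Subtype.val_injective
  obtain ⟨L, hL⟩ := CharacterModule.dual_surjective_of_injective (R := ℤ) δ.range.subtype.toIntLinearMap hinj
    (w : CharacterModule δ.range)
  have hL_apply : ∀ u : U, L (δ u) = toDual y u := by
    intro u
    have h1 : L (δ u) = w ⟨δ u, ⟨u, rfl⟩⟩ :=
      congrArg (fun χ : CharacterModule δ.range ↦ χ ⟨δ u, ⟨u, rfl⟩⟩) hL
    exact h1.trans (hw_apply u)
  obtain ⟨z, hz⟩ := hD.surjective L
  refine ⟨z, hD.injective (AddMonoidHom.ext fun u ↦ ?_)⟩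
  rw [map_sub, AddMonoidHom.sub_apply, hcY, hz]
  change L (cU u) - L u = toDual y u
  rw [← map_sub, ← hδapp]
  exact hL_apply u

end Abstract

/-! ### The `Λ`-linear case: the induced map on coinvariants has finite kernel -/

section Lambda

variable {U : Type*} [AddCommGroup U] (cU : U →+ U) {R₀ : Type*} [AddCommGroup R₀] (res₀ : R₀ →+ U)
  {Y Yr : Type*} [AddCommGroup Y] [_root_.Module (IwasawaAlgebra 2) Y] [AddCommGroup Yr]
  [_root_.Module (IwasawaAlgebra 2) Yr]
  (toDual : Y →+ (U →+ AddCircle (1 : ℚ))) (toDualR : Yr →+ (R₀ →+ AddCircle (1 : ℚ)))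
  (cY : Y →ₗ[IwasawaAlgebra 2] Y)
  (fyr : (Y ⧸ LinearMap.range (cY - 1)) →ₗ[IwasawaAlgebra 2] Yr)

/-- **The kernel of the fine comparison is FINITE** (abstract form). `U` with endomorphism `cU`, `res₀ : R₀ → U` into the fixed
points, `Y ≅ Hom(U, ℚ/ℤ)` with `cY` dual to `cU`, `Yr ≅ Hom(R₀, ℚ/ℤ)`, and a `Λ`-linear `fyr` on the coinvariants
`Y ⧸ range(cY − 1)` dual to `res₀`. If `U^{cU} / res₀ R₀` is finite then `ker fyr` is finite: `[y] ↦ toDual y|_{U^{cU}} mod res₀ R₀`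
embeds `ker fyr` into `Hom(U^{cU}/res₀ R₀, ℚ/ℤ)` (injective by `exists_eq_sub_of_forall_fixed_eq_zero`; the target is finite,
tree `PontryaginCard.finite_characterModule_of_finite`). [cite: GreenbergLNM1716, §3 and §4 (PDF p. 106)] -/
theorem finite_ker_liftQ (hD : Function.Bijective toDual)
    (hcY : ∀ (y : Y) (u : U), toDual (cY y) u = toDual y (cU u))
    (hf : ∀ (y : Y) (r : R₀), toDualR (fyr (Submodule.Quotient.mk y)) r = toDual y (res₀ r))
    [Finite (↥(cU.eqLocus (AddMonoidHom.id U)) ⧸ res₀.range.addSubgroupOf (cU.eqLocus (AddMonoidHom.id U)))] :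
    Finite (LinearMap.ker fyr) := by
  set I : AddSubgroup U := cU.eqLocus (AddMonoidHom.id U) with hI
  set J : AddSubgroup I := res₀.range.addSubgroupOf I with hJ
  have hmemI : ∀ u : U, u ∈ I ↔ cU u = u := fun u ↦ Iff.rfl
  haveI : Finite (I ⧸ J) := ‹_›
  haveI : Finite (CharacterModule (I ⧸ J)) := PontryaginCard.finite_characterModule_of_finite (I ⧸ J)
  -- representative of a class
  let rep : (Y ⧸ LinearMap.range (cY - 1)) → Y := fun q ↦ Classical.choose (Submodule.Quotient.mk_surjective _ q)
  have hrep : ∀ q, Submodule.Quotient.mk (rep q) = q := fun q ↦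
    Classical.choose_spec (Submodule.Quotient.mk_surjective _ q)
  -- for `q ∈ ker fyr`, `toDual (rep q)` vanishes on `res₀ R₀`
  have hvan : ∀ q : LinearMap.ker fyr, ∀ r : R₀, toDual (rep q) (res₀ r) = 0 := by
    intro q r
    rw [← hf, hrep, LinearMap.mem_ker.mp q.2, map_zero, AddMonoidHom.zero_apply]
  have hleJ : ∀ q : LinearMap.ker fyr, J ≤ ((toDual (rep q)).comp I.subtype).ker := by
    intro q x hx
    obtain ⟨r, hr⟩ := (AddSubgroup.mem_addSubgroupOf.mp hx)
    rw [AddMonoidHom.mem_ker, AddMonoidHom.comp_apply, AddSubgroup.coe_subtype, ← hr]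
    exact hvan q r
  let Φ : LinearMap.ker fyr → CharacterModule (I ⧸ J) := fun q ↦
    QuotientAddGroup.lift J ((toDual (rep q)).comp I.subtype) (hleJ q)
  refine Finite.of_injective Φ fun q q' hqq' ↦ ?_
  -- `toDual (rep q - rep q')` vanishes on `I`
  have hI0 : ∀ u : U, cU u = u → toDual (rep q - rep q') u = 0 := by
    intro u hu
    have h := congrArg (fun χ : CharacterModule (I ⧸ J) ↦ χ (QuotientAddGroup.mk ⟨u, (hmemI u).mpr hu⟩)) hqq'
    change QuotientAddGroup.lift J _ (hleJ q) (QuotientAddGroup.mk _) =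
      QuotientAddGroup.lift J _ (hleJ q') (QuotientAddGroup.mk _) at h
    rw [QuotientAddGroup.lift_mk, QuotientAddGroup.lift_mk, AddMonoidHom.comp_apply, AddMonoidHom.comp_apply,
      AddSubgroup.coe_subtype] at h
    rw [map_sub, AddMonoidHom.sub_apply, sub_eq_zero]
    exact h
  obtain ⟨z, hz⟩ := exists_eq_sub_of_forall_fixed_eq_zero cU toDual cY.toAddMonoidHom hD hcY hI0
  apply Subtype.ext
  rw [← hrep q, ← hrep q', Submodule.Quotient.eq]
  refine ⟨z, ?_⟩
  rw [← hz]
  rfl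

/-- **`ℓ₍₂₎(ker fyr) = 0`** under the hypotheses of `finite_ker_liftQ` (a finite `Λ`-module has local length `0` at the height-one
prime `(2)`, `LambdaModP.lengthAt_augIdealP_eq_zero_of_finite`). [cite: GreenbergLNM1716, §4 (PDF p. 106)] -/
theorem lengthAt_ker_liftQ_eq_zero (hD : Function.Bijective toDual)
    (hcY : ∀ (y : Y) (u : U), toDual (cY y) u = toDual y (cU u))
    (hf : ∀ (y : Y) (r : R₀), toDualR (fyr (Submodule.Quotient.mk y)) r = toDual y (res₀ r))
    [Finite (↥(cU.eqLocus (AddMonoidHom.id U)) ⧸ res₀.range.addSubgroupOf (cU.eqLocus (AddMonoidHom.id U)))] :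
    lengthAt (IwasawaAlgebra 2) (LinearMap.ker fyr) ⟨augIdealP 2, isPrime_augIdealP_holds 2⟩ = 0 := by
  haveI := finite_ker_liftQ cU res₀ toDual toDualR cY fyr hD hcY hf
  exact LambdaModP.lengthAt_augIdealP_eq_zero_of_finite 2

end Lambda

/-! ## §2 Seed cell: `ℓ₍₂₎(ker fyʳ) = 0` for every pinned `Y' = X₀(E/ℚ(ζ_{2^∞}))` -/

section SeedCell

open WeierstrassCurve NumberField IsDedekindDomain Field Literature.NumberTheory.GaloisRepresentations ZpExtension
  Literature.NumberTheory.EllipticCurves.GreenbergSelmer Literature.NumberTheory.EllipticCurves.Greenberg1999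

/-- **`χ₂(c) = −1` for some `c ∈ Γ_ℚ`** (the `2`-adic cyclotomic character of `ℚ` is onto `ℤ₂ˣ`, tree
`GaloisRep.cyclotomicCharacter_surjective`; e.g. complex conjugation); such a `c` lies in `ker κ ∖ ker χ₂` for the cyclotomic
`ℤ₂`-extension and generates `Δ = Gal(ℚ(ζ_{2^∞})/ℚ_∞)`. [cite: Washington1997, Ch. 14 p. 321 (χ onto)] -/
theorem exists_cyclotomicCharacter_eq_neg_one :
    ∃ c : absoluteGaloisGroup ℚ, GaloisRep.cyclotomicCharacter ℚ 2 c = -1 :=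
  GaloisRep.cyclotomicCharacter_surjective ℚ 2 (fun _ hn ↦ Polynomial.cyclotomic.irreducible_rat hn) (-1)

variable (κ : ZpExtension ℚ 2) (W : WeierstrassCurve ℚ)

/-- An element with `χ₂ = −1` lies in the kernel of the CYCLOTOMIC `ℤ₂`-extension (`−1` is torsion in `ℤ₂ˣ`).
[cite: Washington1997, §13.1] -/
theorem mem_kerSubgroup_of_cyclotomicCharacter_eq_neg_one (hκ : κ.IsCyclotomic) {c : absoluteGaloisGroup ℚ}
    (hc : GaloisRep.cyclotomicCharacter ℚ 2 c = -1) : c ∈ κ.kerSubgroup := by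
  rw [show κ.kerSubgroup = _ from hκ, Subgroup.mem_comap, CommGroup.mem_torsion]
  change IsOfFinOrder (GaloisRep.cyclotomicCharacter ℚ 2 c)
  rw [hc]
  exact isOfFinOrder_iff_pow_eq_one.mpr ⟨2, two_pos, by rw [neg_one_sq]⟩

/-- **`Δ = ⟨c̄⟩`: invariance under `conj_c` is invariance under every `g ∈ ker κ`.** For the cyclotomic `κ`, `c` with
`χ₂(c) = −1` and a class `x ∈ H¹(ℚ(ζ_{2^∞}), E[2^∞])` (`H¹(ker χ₂, ·)`): if `conj_c x = x` then `conj_g x = x` for all `g ∈ ker κ`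
(`χ₂(g) = ±1`: either `g ∈ ker χ₂` acts trivially, `conjH1_of_mem_holds`, or `g c⁻¹ ∈ ker χ₂` and `conj_g = conj_{gc⁻¹} ∘ conj_c`).
[cite: Washington1997, §13.1] -/
theorem conjH1_eq_of_mem_kerSubgroup (hκ : κ.IsCyclotomic) {c : absoluteGaloisGroup ℚ}
    (hc : GaloisRep.cyclotomicCharacter ℚ 2 c = -1)
    {x : W.subgroupH1 2 (GaloisRep.cyclotomicCharacter ℚ 2).toMonoidHom.ker}
    (hx : W.conjH1 2 (GaloisRep.cyclotomicCharacter ℚ 2).toMonoidHom.ker c x = x)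
    {g : absoluteGaloisGroup ℚ} (hg : g ∈ κ.kerSubgroup) :
    W.conjH1 2 (GaloisRep.cyclotomicCharacter ℚ 2).toMonoidHom.ker g x = x := by
  have htors : GaloisRep.cyclotomicCharacter ℚ 2 g ∈ CommGroup.torsion ℤ_[2]ˣ := by
    rw [show κ.kerSubgroup = _ from hκ] at hg
    exact Subgroup.mem_comap.mp hg
  rcases OddSplit.eq_one_or_eq_neg_one_of_mem_torsion htors with h1 | h1
  · rw [W.conjH1_of_mem_holds 2 (GaloisRep.cyclotomicCharacter ℚ 2).toMonoidHom.ker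
      (show g ∈ (GaloisRep.cyclotomicCharacter ℚ 2).toMonoidHom.ker from (MonoidHom.mem_ker).mpr h1),
      AddMonoidHom.id_apply]
  · have hmem : g * c⁻¹ ∈ (GaloisRep.cyclotomicCharacter ℚ 2).toMonoidHom.ker := by
      have e1 : (GaloisRep.cyclotomicCharacter ℚ 2).toMonoidHom g = -1 := h1
      have e2 : (GaloisRep.cyclotomicCharacter ℚ 2).toMonoidHom c = -1 := hc
      rw [MonoidHom.mem_ker, map_mul, map_inv, e1, e2, inv_neg, inv_one, neg_mul_neg, one_mul]
    rw [show g = (g * c⁻¹) * c by group,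
      W.conjH1_mul_holds 2 (GaloisRep.cyclotomicCharacter ℚ 2).toMonoidHom.ker (g * c⁻¹) c,
      AddMonoidHom.comp_apply, hx,
      W.conjH1_of_mem_holds 2 (GaloisRep.cyclotomicCharacter ℚ 2).toMonoidHom.ker hmem, AddMonoidHom.id_apply]

variable [W.IsElliptic]

/-- **The fixed fine classes upstairs modulo the restricted relaxed fine classes are FINITE (seed cell).** For an elliptic `W/ℚ`
without a rational point of order `2`, the cyclotomic `κ`, `c` with `χ₂(c) = −1`, `U = Sel₀(ℚ(ζ_{2^∞}), E[2^∞])` (Greenberg's strict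
Selmer group of the fine data over `ker χ₂`) with the endomorphism `conj_c`, and `res₀ : Sel₀^{rel ∞}(ℚ_∞) → U` (restriction,
`InfResRel.resOfLe_fineRelaxed_mem_strictSelmerGroupOver_kerCyc`): `U^{conj_c} / res₀(Sel₀^{rel ∞})` is finite — every
`conj_c`-fixed class is a restriction (`conjH1_eq_of_mem_kerSubgroup` + `InfResSurj`), and the source defect
`L / Sel₀^{rel ∞}` is finite (`CokerAtTwo.finite_fineDefect_two`). [cite: GreenbergLNM1716, §3 and §4 (PDF p. 106)] -/
theorem finite_fixed_quotient_range (ht : ∀ x : ℚ, ¬ HasRationalTwoTorsionX W x) (hκ : κ.IsCyclotomic)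
    {c : absoluteGaloisGroup ℚ} (hc : GaloisRep.cyclotomicCharacter ℚ 2 c = -1) :
    let Hχ := (GaloisRep.cyclotomicCharacter ℚ 2).toMonoidHom.ker
    let U : AddSubgroup (W.subgroupH1 2 Hχ) :=
      strictSelmerGroupOver Hχ (W.geomPrimaryTorsion 2) 2 (fineData (W.geomPrimaryTorsion 2) 2)
    let cU : U →+ U := ((W.conjH1 2 Hχ c).comp U.subtype).codRestrict U
      fun u ↦ conjH1_mem_strictSelmerGroupOver c u.2
    let res₀ : W.fineSelmerInftyRelaxedInf κ →+ U :=
      ((W.resOfLe 2 (InfRes.ker_cyclotomicCharacter_le_kerSubgroup κ hκ)).comp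
        (W.fineSelmerInftyRelaxedInf κ).subtype).codRestrict U
        fun s ↦ (InfResRel.resOfLe_fineRelaxed_mem_strictSelmerGroupOver_kerCyc κ W hκ s.2).1
    Finite (↥(cU.eqLocus (AddMonoidHom.id U)) ⧸ res₀.range.addSubgroupOf (cU.eqLocus (AddMonoidHom.id U))) := by
  intro Hχ U cU res₀
  set h := InfRes.ker_cyclotomicCharacter_le_kerSubgroup κ hκ with hh
  set M := W.geomPrimaryTorsion 2 with hM
  set I : AddSubgroup U := cU.eqLocus (AddMonoidHom.id U) with hI
  set L : AddSubgroup (W.subgroupH1 2 κ.kerSubgroup) :=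
    (strictSelmerGroupOver Hχ M 2 (fineData M 2)).comap (W.resOfLe 2 h) with hL
  have hcmem : c ∈ κ.kerSubgroup := mem_kerSubgroup_of_cyclotomicCharacter_eq_neg_one κ hκ hc
  -- `res : L → I`
  have hresI : ∀ x : L, (⟨W.resOfLe 2 h x, x.2⟩ : U) ∈ I := by
    intro x
    change cU ⟨W.resOfLe 2 h x, x.2⟩ = ⟨W.resOfLe 2 h x, x.2⟩
    apply Subtype.ext
    exact conjH1_resOfLe_of_mem (M := M) h hcmem (x : W.subgroupH1 2 κ.kerSubgroup)
  let fL : L →+ I :=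
    { toFun := fun x ↦ ⟨⟨W.resOfLe 2 h x, x.2⟩, hresI x⟩
      map_zero' := Subtype.ext (Subtype.ext (by
        change W.resOfLe 2 h ((0 : L) : W.subgroupH1 2 κ.kerSubgroup) = _
        rw [ZeroMemClass.coe_zero, map_zero]; rfl))
      map_add' := fun x y ↦ Subtype.ext (Subtype.ext (by
        change W.resOfLe 2 h ((x + y : L) : W.subgroupH1 2 κ.kerSubgroup) = _
        rw [AddSubgroup.coe_add, map_add]; rfl)) }
  have hfL : ∀ x : L, (((fL x : I) : U) : W.subgroupH1 2 Hχ) = W.resOfLe 2 h x := fun _ ↦ rfl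
  -- onto (every `conj_c`-fixed fine class is a restriction)
  have hfLsurj : Function.Surjective fL := by
    rintro ⟨⟨x, hxU⟩, hxI⟩
    have hfix : W.conjH1 2 Hχ c x = x := by
      have e := congrArg (fun u : U ↦ (u : W.subgroupH1 2 Hχ)) (show cU ⟨x, hxU⟩ = ⟨x, hxU⟩ from hxI)
      exact e
    obtain ⟨y, hy⟩ := InfResSurj.exists_resOfLe_eq_of_forall_conjH1_eq_two (W := W) (κ₂ := κ) ht hκ x
      fun g hg ↦ conjH1_eq_of_mem_kerSubgroup κ W hκ hc hfix hg
    refine ⟨⟨y, ?_⟩, Subtype.ext (Subtype.ext ?_)⟩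
    · change W.resOfLe 2 h y ∈ strictSelmerGroupOver Hχ M 2 (fineData M 2)
      rw [hy]; exact hxU
    · rw [hfL]; exact hy
  -- compatible with the two «relaxed fine» subgroups
  have hle : (W.fineSelmerInftyRelaxedInf κ).addSubgroupOf L ≤ (res₀.range.addSubgroupOf I).comap fL := by
    intro x hx
    rw [AddSubgroup.mem_comap, AddSubgroup.mem_addSubgroupOf]
    refine ⟨⟨(x : W.subgroupH1 2 κ.kerSubgroup), AddSubgroup.mem_addSubgroupOf.mp hx⟩, Subtype.ext ?_⟩
    rfl
  haveI := CokerAtTwo.finite_fineDefect_two κ W hκ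
  refine Finite.of_surjective (QuotientAddGroup.map _ _ fL hle) fun q ↦ ?_
  induction q using QuotientAddGroup.induction_on with
  | H s =>
    obtain ⟨x, rfl⟩ := hfLsurj s
    exact ⟨QuotientAddGroup.mk x, rfl⟩

/-- **`ℓ₍₂₎(ker fyʳ) = 0` ON THE SEED CELL, for every pinned `Y' = X₀(E/ℚ(ζ_{2^∞}))`.** Let `W/ℚ` be elliptic without a rational
point of order `2`, `κ` the cyclotomic `ℤ₂`-extension with topological generator `γ`, `c ∈ Γ_ℚ` with `χ₂(c) = −1`,
`Yr : W.FineSelmerDualDataRelaxedInf κ γ` the pinned relaxed fine dual over `ℚ_∞` (typer p600292). For ANY `Λ`-module `Y'` with an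
additive bijection `toDual' : Y' ≅ Hom(Sel₀(ℚ(ζ_{2^∞}), E[2^∞]), ℚ/ℤ)` (Greenberg's strict fine Selmer group over `ker χ₂`), ANY
`Λ`-linear `cY` dual to `conj_c`, and ANY `Λ`-linear `fyr : Y' ⧸ range(cY − 1) → Yr.X` dual to the restriction
`res₀ : Sel₀^{rel ∞}(ℚ_∞) → Sel₀(ℚ(ζ_{2^∞}))`: **`lengthAt Λ (ker fyr) (2) = 0`** — the inf–res conjunct of K₂ⁿᵉᵗʳ, with no appeal to
Imai or Ribet, for both signs of `Δ_W`. [cite: GreenbergLNM1716, §3 and §4 (PDF p. 106)] [cite: Kato2004Asterisque, §17.13] -/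
theorem lengthAt_ker_fineComparison_eq_zero (ht : ∀ x : ℚ, ¬ HasRationalTwoTorsionX W x) (hκ : κ.IsCyclotomic)
    {γ : absoluteGaloisGroup ℚ} (Yr : W.FineSelmerDualDataRelaxedInf κ γ)
    {c : absoluteGaloisGroup ℚ} (hc : GaloisRep.cyclotomicCharacter ℚ 2 c = -1)
    {Y' : Type*} [AddCommGroup Y'] [_root_.Module (IwasawaAlgebra 2) Y']
    (toDual' : Y' →+ (strictSelmerGroupOver (GaloisRep.cyclotomicCharacter ℚ 2).toMonoidHom.ker (W.geomPrimaryTorsion 2) 2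
      (fineData (W.geomPrimaryTorsion 2) 2) →+ AddCircle (1 : ℚ)))
    (hD : Function.Bijective toDual') (cY : Y' →ₗ[IwasawaAlgebra 2] Y')
    (hcY : ∀ (y : Y') (u : strictSelmerGroupOver (GaloisRep.cyclotomicCharacter ℚ 2).toMonoidHom.ker
        (W.geomPrimaryTorsion 2) 2 (fineData (W.geomPrimaryTorsion 2) 2)),
      toDual' (cY y) u = toDual' y ⟨W.conjH1 2 _ c u, conjH1_mem_strictSelmerGroupOver c u.2⟩)
    (fyr : (Y' ⧸ LinearMap.range (cY - 1)) →ₗ[IwasawaAlgebra 2] Yr.X)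
    (hf : ∀ (y : Y') (s : W.fineSelmerInftyRelaxedInf κ),
      Yr.toDual (fyr (Submodule.Quotient.mk y)) s =
        toDual' y ⟨W.resOfLe 2 (InfRes.ker_cyclotomicCharacter_le_kerSubgroup κ hκ) s,
          (InfResRel.resOfLe_fineRelaxed_mem_strictSelmerGroupOver_kerCyc κ W hκ s.2).1⟩) :
    lengthAt (IwasawaAlgebra 2) (LinearMap.ker fyr) ⟨augIdealP 2, isPrime_augIdealP_holds 2⟩ = 0 := by
  let U : AddSubgroup (W.subgroupH1 2 (GaloisRep.cyclotomicCharacter ℚ 2).toMonoidHom.ker) :=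
    strictSelmerGroupOver (GaloisRep.cyclotomicCharacter ℚ 2).toMonoidHom.ker (W.geomPrimaryTorsion 2) 2
      (fineData (W.geomPrimaryTorsion 2) 2)
  let cU : U →+ U := ((W.conjH1 2 (GaloisRep.cyclotomicCharacter ℚ 2).toMonoidHom.ker c).comp U.subtype).codRestrict
    U fun u ↦ conjH1_mem_strictSelmerGroupOver c u.2
  let res₀ : W.fineSelmerInftyRelaxedInf κ →+ U :=
    ((W.resOfLe 2 (InfRes.ker_cyclotomicCharacter_le_kerSubgroup κ hκ)).comp
      (W.fineSelmerInftyRelaxedInf κ).subtype).codRestrict U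
      fun s ↦ (InfResRel.resOfLe_fineRelaxed_mem_strictSelmerGroupOver_kerCyc κ W hκ s.2).1
  haveI := finite_fixed_quotient_range κ W ht hκ hc
  exact lengthAt_ker_liftQ_eq_zero cU res₀ toDual' Yr.toDual cY fyr hD (fun y u ↦ hcY y u) (fun y r ↦ hf y r)

end SeedCell

end Summit.BirchSwinnertonDyer.BirchSwinnertonDyer.Theorems.AlignedTransportAtTwoFineRoad.FineKernel

end
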